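import Literature.NumberTheory.Sieve.CubicFormPairSieveTwoClass
import Literature.NumberTheory.Sieve.HeathBrownWeightClassSums
import Literature.NumberTheory.Sieve.HeathBrownWeightFourthMoment
import Literature.NumberTheory.Sieve.RoughModelPairCount
import Mathlib.Analysis.SpecialFunctions.Pow.Asymptotics
import HarnessLib

/-!
# The sieve main term of the box model of the Heath-Brown weight against the rough model, PROVED

Topic `Literature/NumberTheory/Sieve`, namespace `Literature.NumberTheory.Sieve.CubicMinorant`
(objects of `CubicMinorantDefs.lean`: `hbX`, `hbEta`, `hbWeight`, `roughLevel`, `roughPrimorial`,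
`roughModel`; and of `HeathBrownWeightClassSums.lean`: `hbSide`).

Setting (the binary problem `n = p + (x³ + 2y³)` treated by dispersion; parity-ideate route
`GoldbachHeathBrownDispersion`, crux «ModelMainTerm»). With `X = (N/6)^{1/3}`, `η = (log X)^{−c}`,
`z = (log 2N)^B`, `P = P(z) = ∏_{p<z} p`, the box `ℬ = {(x, y) : X < x, y ≤ X(1+η)}` of integer pairs,
the rough model `g(m) = (P/φ(P))·1[(m, P) = 1]`, the mass `U = ∑_{k ≤ N} f₃(k)` of the Heath-Brown
weight, `R = #{(x,y) ∈ ℬ : (x³+2y³, P) = 1}` and the BOX MODEL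
`ũ(m) = (U/R) · #{(x, y) ∈ ℬ : x³ + 2y³ = m, (m, P) = 1}` (a sieve model of `f₃` of the same mass), we
PROVE:

* **`boxModel_mainTerm_lower`** — there is an ABSOLUTE `c₀ > 0` (`c₀ = localFactorConst/4`, chosen
  before `c` and `B`) such that for all `c, B > 0`, all `N ≥ N₀(c, B)` and every EVEN `n ∈ (N, 2N]`,
  `∑_{k ≤ N} ũ(k) g(n − k) ≥ c₀ U`.
  (`boxModel_mainTerm_lower'` is the same statement with the abbreviations inlined.)

Proof (the classical route, [HalberstamRichert1974, Thm 2.5 with Thm 2.2; Vaughan1997, §3.2]):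
(1) the REARRANGEMENT `∑_k ũ(k) g(n−k) = (U/R)·(P/φ(P))·T`, `T = #{(x,y) ∈ ℬ : (v, P) = (n − v, P) = 1}`,
`v = x³ + 2y³` (`sum_boxModel_mul_roughModel_eq`; every box value lies in `[1, N]` eventually, tree
`eventually_three_mul_floor_cube_le`); (2) the two-dimensional Fundamental Lemma LOWER bound with the
local factors extracted, tree `CubicPrimes.twoClassCount_box_weighted_ge`:
`(P/φ)T ≥ c₁ L² V(z) − C₁(L² V(z) e^{−log D/log z} + (P/φ)(L+D)D(log D)^16)` with the absolute
`c₁ = localFactorConst` (Hasse bound for `x³ + 2y³ = a` over `𝔽_p`), and the one-class two-sided count,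
tree `CubicPrimes.abs_oneClassCount_box_sub_le`: `|R − L² V(z)| ≤ C₂(L² V(z) e^{−log D/log z} + (L+D)D(log D)⁸)`,
`L = ⌊X(1+η)⌋ − ⌊X⌋` the integer side of the box (tree `hbBox_eq`); (3) the choice `D = z^J` with a
CONSTANT `J` (`C₁e^{−J} ≤ c₁/4`, `C₂e^{−J} ≤ 1/4`), under which all remaining error terms are
`≤ (polynomial in z) · L` while the main terms are `≫ L²/(log z)³` (tree `oneClassProduct_ge`,
`primesProdBelow_div_totient_le`), so that ONE growth condition `C_T z^{J+20} ≤ L` suffices — and it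
holds eventually because `L ≥ Xη − 1 ≥ X^{1/2} − 1` while `z^{J+20} = (log 12X³)^{B(J+20)}`
(`eventually_mul_roughLevel_pow_le_hbSide`); (4) then `(P/φ)T ≥ c₁L²V/2`, `R ≤ 3L²V/2`, whence
`(P/φ)T/R ≥ c₁/3 ≥ c₀`.

No new facts (0 `def … : Prop`); constants absolute as stated. Written for the parity-ideate cell
(literature seat g14, 2026-08-27).

## References

* [HalberstamRichert1974] H. Halberstam, H.-E. Richert, *Sieve Methods*, Academic Press 1974, Thm 2.5
  (Fundamental Lemma), Thm 2.2.
* [Vaughan1997] R. C. Vaughan, *The Hardy–Littlewood method*, 2nd ed., CUP 1997, §3.2 (binary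
  problems: exceptional-set / variance set-up, main term by sieve).
* [HeathBrownActa2001] D. R. Heath-Brown, *Primes represented by x³ + 2y³*, Acta Math. 186 (2001),
  Theorem 1 (the box `X < x, y ≤ X(1+η)`).
* [IrelandRosen1990] K. Ireland, M. Rosen, *A classical introduction to modern number theory*, GTM 84,
  Ch. 8 §3, §7 Thm 5 (the local counts behind `localFactorConst`).

## Mathlib / tree search

Tree: `twoClassCount_box_weighted_ge`, `abs_oneClassCount_box_sub_le`, `oneClassProduct_ge/_pos/_le_one`,
`localFactorConst(_pos/_le_one)`, `pairBox`, `pairValue` (`CubicFormPairSieveTwoClass`); `hbBox_eq`,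
`Ioc_floor_eq_Ioc_add_hbSide`, `hbSide` (`HeathBrownWeightClassSums`); `hbX_pow_three`, `hbX_nonneg`,
`tendsto_hbX`, `eventually_three_mul_floor_cube_le` (`HeathBrownWeightFourthMoment`);
`primesProdBelow_div_totient_le` (`RoughModelPairCount`). Mathlib: `isLittleO_log_rpow_rpow_atTop`,
`Finset.sum_fiberwise_eq_sum_filter'`, `Real.log_le_sub_one_of_pos`, `Real.log_two_gt_d9`.
`lean search 'boxModel|sum_boxModel'`: nothing before this file.
-/

noncomputable section

open Finset Filter Topology
open Literature.NumberTheory.Sieve Literature.NumberTheory.Sieve.CubicPrimes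

namespace Literature.NumberTheory.Sieve.CubicMinorant

/-! ### The rearrangement `∑_k ũ(k) g(n − k) = (U/R)·(P/φ(P))·T` -/

/-- Fibrewise rearrangement: `∑_{k ∈ S} #{xy ∈ ℬ : v(xy) = k, p k} · G(k) = ∑_{xy ∈ ℬ, v(xy) ∈ S, p (v xy)} G(v xy)`
(pure counting; private helper). [folklore] -/
private theorem sum_card_fiber_mul_eq (box : Finset (ℕ × ℕ)) (S : Finset ℕ) (v : ℕ × ℕ → ℕ)
    (p : ℕ → Prop) [DecidablePred p] (G : ℕ → ℝ) :
    ∑ k ∈ S, (#{xy ∈ box | v xy = k ∧ p k} : ℝ) * G k =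
      ∑ xy ∈ box with (v xy ∈ S ∧ p (v xy)), G (v xy) := by
  have h1 : ∀ k ∈ S, (#{xy ∈ box | v xy = k ∧ p k} : ℝ) * G k =
      ∑ xy ∈ (box.filter (fun xy => p (v xy))) with v xy = k, G k := by
    intro k _
    have hset : (box.filter (fun xy => p (v xy))).filter (fun xy => v xy = k) =
        box.filter (fun xy => v xy = k ∧ p k) := by
      rw [filter_filter]
      refine filter_congr fun xy _ => ?_
      constructor
      · rintro ⟨hp, hk⟩
        exact ⟨hk, hk ▸ hp⟩
      · rintro ⟨hk, hp⟩
        exact ⟨hk ▸ hp, hk⟩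
    rw [hset, sum_const, nsmul_eq_mul]
  rw [sum_congr rfl h1, sum_fiberwise_eq_sum_filter', filter_filter]
  exact sum_congr (filter_congr fun xy _ => and_comm) fun _ _ => rfl

/-- `∑_{xy ∈ F} (if q xy then Q else 0) = Q · #{xy ∈ F : q xy}`. [folklore] -/
private theorem sum_ite_const_eq_mul_card (F : Finset (ℕ × ℕ)) (q : ℕ × ℕ → Prop) [DecidablePred q]
    (Q : ℝ) : ∑ xy ∈ F, (if q xy then Q else 0) = Q * #(F.filter q) := by
  rw [← sum_filter, sum_const, nsmul_eq_mul, mul_comm]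

/-- **The rearrangement**: with `P = P(z)` the rough primorial at `2N`, `g` the rough model at `2N`
and `ũ(k) = (U/R)·#{xy ∈ ℬ : v(xy) = k, (k, P) = 1}`,
`∑_{k ∈ [1,N]} ũ(k) g(n − k) = (U/R) · (P/φ(P)) · #{xy ∈ ℬ : v ∈ [1, N], (v, P) = 1, (n − v, P) = 1}`.
[cite: Vaughan1997, §3.2 (the main term of a binary problem as a sifted count)] -/
theorem sum_boxModel_mul_roughModel_eq (B : ℝ) (N n : ℕ) (box : Finset (ℕ × ℕ)) (U R : ℝ) :
    ∑ k ∈ Icc 1 N, U / R * (#{xy ∈ box | xy.1 ^ 3 + 2 * xy.2 ^ 3 = k ∧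
        Nat.Coprime k (roughPrimorial B (2 * N))} : ℝ) * roughModel B (2 * N) (n - k) =
      U / R * (((roughPrimorial B (2 * N) : ℝ) / (Nat.totient (roughPrimorial B (2 * N)) : ℝ)) *
        #{xy ∈ box | (xy.1 ^ 3 + 2 * xy.2 ^ 3 ∈ Icc 1 N ∧
          Nat.Coprime (xy.1 ^ 3 + 2 * xy.2 ^ 3) (roughPrimorial B (2 * N))) ∧
          Nat.Coprime (n - (xy.1 ^ 3 + 2 * xy.2 ^ 3)) (roughPrimorial B (2 * N))}) := by
  set P := roughPrimorial B (2 * N) with hP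
  have h1 : ∑ k ∈ Icc 1 N, U / R * (#{xy ∈ box | xy.1 ^ 3 + 2 * xy.2 ^ 3 = k ∧ Nat.Coprime k P} : ℝ) *
        roughModel B (2 * N) (n - k) =
      U / R * ∑ k ∈ Icc 1 N, (#{xy ∈ box | xy.1 ^ 3 + 2 * xy.2 ^ 3 = k ∧ Nat.Coprime k P} : ℝ) *
        roughModel B (2 * N) (n - k) := by
    rw [mul_sum]
    exact sum_congr rfl fun k _ => by ring
  rw [h1, sum_card_fiber_mul_eq box (Icc 1 N) (fun xy => xy.1 ^ 3 + 2 * xy.2 ^ 3)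
    (fun k => Nat.Coprime k P) (fun k => roughModel B (2 * N) (n - k))]
  congr 1
  have hg : ∀ xy : ℕ × ℕ, roughModel B (2 * N) (n - (xy.1 ^ 3 + 2 * xy.2 ^ 3)) =
      if Nat.Coprime (n - (xy.1 ^ 3 + 2 * xy.2 ^ 3)) P then (P : ℝ) / (Nat.totient P : ℝ) else 0 :=
    fun xy => rfl
  simp_rw [hg]
  rw [sum_ite_const_eq_mul_card, filter_filter]

/-! ### Growth of the box side against powers of the sifting level -/

/-- `(2N : ℝ) = 12 X³` (from `X³ = N/6`). [cite: HeathBrownActa2001, Theorem 1 (the box X < x, y ≤ X(1+η))] -/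
theorem cast_two_mul_eq_twelve_mul_hbX_pow (N : ℕ) : ((2 * N : ℕ) : ℝ) = 12 * hbX N ^ 3 := by
  rw [hbX_pow_three]; push_cast; ring

/-- Real-variable form of the growth comparison: for `r ≥ 0` and any `C`, eventually in `x`,
`C (log(12x³))^r + 1 ≤ x^{1/2}` (powers of `log` are `o(x^{1/2})`). [folklore] -/
private theorem eventually_mul_log_rpow_add_one_le_sqrt (C r : ℝ) (hr : 0 ≤ r) :
    ∀ᶠ x : ℝ in atTop, C * Real.log (12 * x ^ 3) ^ r + 1 ≤ x ^ (1 / 2 : ℝ) := by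
  -- `(log x)^r ≤ ε x^{1/2}` eventually, with `ε (|C| 4^r) ≤ 1/2`
  set K := |C| * (4 : ℝ) ^ r + 1 with hK
  have hK0 : 0 < K := by positivity
  have hε : 0 < 1 / (2 * K) := by positivity
  have hlo := (isLittleO_log_rpow_rpow_atTop r (by norm_num : (0 : ℝ) < 1 / 2)).bound hε
  filter_upwards [hlo, eventually_ge_atTop (12 : ℝ), eventually_ge_atTop (4 : ℝ)] with x hx hx12 hx4
  have hx0 : 0 < x := by linarith
  have hx1 : 1 < x := by linarith
  have hlogx : 0 < Real.log x := Real.log_pos hx1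
  have hsqrt0 : 0 < x ^ (1 / 2 : ℝ) := Real.rpow_pos_of_pos hx0 _
  rw [Real.norm_of_nonneg (Real.rpow_nonneg hlogx.le _), Real.norm_of_nonneg hsqrt0.le] at hx
  -- `log(12 x³) ≤ 4 log x`
  have hlog12 : Real.log 12 ≤ Real.log x := Real.log_le_log (by norm_num) hx12
  have hl3 : Real.log (12 * x ^ 3) = Real.log 12 + 3 * Real.log x := by
    rw [Real.log_mul (by norm_num) (by positivity), Real.log_pow]; push_cast; ring
  have hl4 : Real.log (12 * x ^ 3) ≤ 4 * Real.log x := by rw [hl3]; linarith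
  have hl0 : 0 ≤ Real.log (12 * x ^ 3) := by rw [hl3]; positivity
  have hpow : Real.log (12 * x ^ 3) ^ r ≤ (4 : ℝ) ^ r * Real.log x ^ r := by
    calc Real.log (12 * x ^ 3) ^ r ≤ (4 * Real.log x) ^ r := Real.rpow_le_rpow hl0 hl4 hr
      _ = (4 : ℝ) ^ r * Real.log x ^ r := Real.mul_rpow (by norm_num) hlogx.le
  -- `C (log 12x³)^r ≤ |C| 4^r (log x)^r ≤ |C| 4^r ε x^{1/2} ≤ x^{1/2}/2`
  have hC : C * Real.log (12 * x ^ 3) ^ r ≤ |C| * ((4 : ℝ) ^ r * Real.log x ^ r) :=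
    (mul_le_mul_of_nonneg_left hpow (abs_nonneg C)).trans' (by
      have := le_abs_self C
      have h0 : 0 ≤ Real.log (12 * x ^ 3) ^ r := Real.rpow_nonneg hl0 _
      nlinarith)
  have hmain : |C| * ((4 : ℝ) ^ r * Real.log x ^ r) ≤ x ^ (1 / 2 : ℝ) / 2 := by
    have h4r : 0 ≤ |C| * (4 : ℝ) ^ r := by positivity
    calc |C| * ((4 : ℝ) ^ r * Real.log x ^ r) = (|C| * (4 : ℝ) ^ r) * Real.log x ^ r := by ring
      _ ≤ (|C| * (4 : ℝ) ^ r) * (1 / (2 * K) * x ^ (1 / 2 : ℝ)) := mul_le_mul_of_nonneg_left hx h4r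
      _ = (|C| * (4 : ℝ) ^ r) / K * (x ^ (1 / 2 : ℝ) / 2) := by field_simp
      _ ≤ 1 * (x ^ (1 / 2 : ℝ) / 2) := by
          refine mul_le_mul_of_nonneg_right ?_ (by positivity)
          rw [div_le_one hK0, hK]; linarith
      _ = x ^ (1 / 2 : ℝ) / 2 := one_mul _
  -- `1 ≤ x^{1/2}/2` for `x ≥ 4`
  have hone : (1 : ℝ) ≤ x ^ (1 / 2 : ℝ) / 2 := by
    have h4 : (4 : ℝ) ^ (1 / 2 : ℝ) ≤ x ^ (1 / 2 : ℝ) := Real.rpow_le_rpow (by norm_num) hx4 (by norm_num)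
    have h2 : (4 : ℝ) ^ (1 / 2 : ℝ) = 2 := by
      rw [show (4 : ℝ) = 2 ^ (2 : ℝ) by norm_num, ← Real.rpow_mul (by norm_num)]; norm_num
    linarith
  linarith

/-- **The integer side of Heath-Brown's box dominates every power of the sifting level**: for any
`C`, `K` and `B > 0`, eventually in `N`, `C · z^K ≤ L` with `z = (log 2N)^B` (`roughLevel B (2N)`) and
`L = hbSide c N = ⌊X(1+η)⌋ − ⌊X⌋ ≥ Xη − 1 ≥ X^{1/2} − 1`. [cite: HeathBrownActa2001, Theorem 1 (the box X < x, y ≤ X(1+η) with η = (log X)^{-c})] -/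
theorem eventually_mul_roughLevel_pow_le_hbSide (c C : ℝ) {B : ℝ} (hB : 0 < B) (K : ℕ) :
    ∀ᶠ N : ℕ in atTop, C * roughLevel B (2 * N) ^ K ≤ (hbSide c N : ℝ) := by
  -- (a) `L ≥ Xη − 1` once `Xη ≥ 0`
  have hXη := tendsto_hbX_mul_hbEta_atTop c
  have ha : ∀ᶠ N : ℕ in atTop, hbX N * hbEta c N - 1 ≤ (hbSide c N : ℝ) := by
    filter_upwards [hXη.eventually_ge_atTop 0] with N hN
    have hX := hbX_nonneg N
    have hη0 : 0 ≤ hbEta c N := by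
      rcases hX.eq_or_lt with h | h
      · unfold hbEta
        rw [← h, Real.log_zero]
        exact Real.rpow_nonneg le_rfl _
      · nlinarith
    have hY : hbX N ≤ hbX N * (1 + hbEta c N) := by nlinarith
    have hAM : ⌊hbX N⌋₊ ≤ ⌊hbX N * (1 + hbEta c N)⌋₊ := Nat.floor_le_floor hY
    rw [hbSide_def, Nat.cast_sub hAM]
    have h1 : hbX N * (1 + hbEta c N) - 1 < (⌊hbX N * (1 + hbEta c N)⌋₊ : ℝ) := Nat.sub_one_lt_floor _
    have h2 : (⌊hbX N⌋₊ : ℝ) ≤ hbX N := Nat.floor_le hX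
    linarith
  -- (b) `X^{1/2} ≤ Xη` eventually (`(log X)^c ≤ X^{1/2}`)
  have hb_real : ∀ᶠ x : ℝ in atTop, x ^ (1 / 2 : ℝ) ≤ x * Real.log x ^ (-c) := by
    have hlo : ∀ᶠ x : ℝ in atTop, ‖Real.log x ^ c‖ ≤ 1 * ‖x ^ (1 / 2 : ℝ)‖ :=
      (isLittleO_log_rpow_rpow_atTop c (by norm_num : (0 : ℝ) < 1 / 2)).bound one_pos
    filter_upwards [hlo, eventually_gt_atTop (1 : ℝ)] with x hx hx1
    have hlogpos : 0 < Real.log x := Real.log_pos hx1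
    have hLc : 0 < Real.log x ^ c := Real.rpow_pos_of_pos hlogpos c
    rw [one_mul, Real.norm_of_nonneg hLc.le, Real.norm_of_nonneg (Real.rpow_nonneg (by linarith) _)] at hx
    rw [Real.rpow_neg hlogpos.le, ← div_eq_mul_inv, le_div_iff₀ hLc]
    have hxhalf : 0 ≤ x ^ (1 / 2 : ℝ) := Real.rpow_nonneg (by linarith) _
    calc x ^ (1 / 2 : ℝ) * Real.log x ^ c ≤ x ^ (1 / 2 : ℝ) * x ^ (1 / 2 : ℝ) :=
          mul_le_mul_of_nonneg_left hx hxhalf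
      _ = x := by rw [← Real.rpow_add (by linarith)]; norm_num
  have hb : ∀ᶠ N : ℕ in atTop, hbX N ^ (1 / 2 : ℝ) ≤ hbX N * hbEta c N := by
    filter_upwards [tendsto_hbX.eventually hb_real] with N hN
    simpa [hbEta] using hN
  -- (c) `C z^K + 1 ≤ X^{1/2}` eventually (`z^K = (log 12X³)^{BK}`)
  have hc_real := eventually_mul_log_rpow_add_one_le_sqrt C (B * K) (by positivity)
  have hc' : ∀ᶠ N : ℕ in atTop, C * roughLevel B (2 * N) ^ K + 1 ≤ hbX N ^ (1 / 2 : ℝ) := by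
    filter_upwards [tendsto_hbX.eventually hc_real, eventually_ge_atTop 1] with N hN hN1
    have hz : roughLevel B (2 * N) ^ K = Real.log (12 * hbX N ^ 3) ^ (B * K) := by
      rw [roughLevel, cast_two_mul_eq_twelve_mul_hbX_pow, ← Real.rpow_natCast,
        ← Real.rpow_mul]
      have hN' : (1 : ℝ) ≤ 12 * hbX N ^ 3 := by
        rw [hbX_pow_three]
        have : (1 : ℝ) ≤ N := by exact_mod_cast hN1
        linarith
      exact Real.log_nonneg hN'
    rwa [hz]
  filter_upwards [ha, hb, hc'] with N h1 h2 h3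
  linarith

/-- The sifting level `z = (log 2N)^B` tends to infinity (`B > 0`). [folklore] -/
private theorem tendsto_roughLevel_two_mul_atTop {B : ℝ} (hB : 0 < B) :
    Tendsto (fun N : ℕ => roughLevel B (2 * N)) atTop atTop := by
  have h2N : Tendsto (fun N : ℕ => ((2 * N : ℕ) : ℝ)) atTop atTop :=
    tendsto_natCast_atTop_atTop.comp
      (tendsto_atTop_mono (fun N : ℕ => show id N ≤ 2 * N by dsimp only [id]; omega) tendsto_id)
  exact ((tendsto_rpow_atTop hB).comp (Real.tendsto_log_atTop.comp h2N)).congr fun N => rfl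

/-! ### Book-keeping lemmas for the main term -/

/-- Choice of the Fundamental-Lemma parameter: a natural `J ≥ 1` with `e^{−J}` below two prescribed
positive levels. [folklore] -/
private theorem exists_nat_exp_neg_le {a b : ℝ} (ha : 0 < a) (hb : 0 < b) :
    ∃ J : ℕ, 1 ≤ J ∧ Real.exp (-(J : ℝ)) ≤ a ∧ Real.exp (-(J : ℝ)) ≤ b := by
  have h : Tendsto (fun J : ℕ => Real.exp (-(J : ℝ))) atTop (𝓝 0) :=
    Real.tendsto_exp_neg_atTop_nhds_zero.comp tendsto_natCast_atTop_atTop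
  obtain ⟨J, hJ⟩ := ((h.eventually (eventually_le_nhds ha)).and
    ((h.eventually (eventually_le_nhds hb)).and (eventually_ge_atTop 1))).exists
  exact ⟨J, hJ.2.2, hJ.1, hJ.2.1⟩

/-- Every value `x³ + 2y³` on the box `(A, A+L]²` lies in `[1, N]` once `3(A+L)³ ≤ N`. [cite: HeathBrownActa2001, Theorem 1 (the box X < x, y ≤ X(1+η): its values lie in (X³, 3X³(1+η)³])] -/
theorem pairBox_value_mem_Icc {A L M N : ℕ} (hAL : A + L = M) (hM : 3 * M ^ 3 ≤ N) :
    ∀ xy ∈ pairBox A A L, xy.1 ^ 3 + 2 * xy.2 ^ 3 ∈ Icc 1 N := by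
  rintro ⟨x, y⟩ hxy
  rw [pairBox, mem_product, mem_Ioc, mem_Ioc, hAL] at hxy
  obtain ⟨⟨hx1, hx2⟩, -, hy2⟩ := hxy
  rw [mem_Icc]
  have hx3 : x ^ 3 ≤ M ^ 3 := Nat.pow_le_pow_left hx2 3
  have hy3 : y ^ 3 ≤ M ^ 3 := Nat.pow_le_pow_left hy2 3
  have hx1' : 1 ≤ x ^ 3 := Nat.one_le_pow _ _ (by omega)
  constructor
  · exact hx1'.trans (Nat.le_add_right _ _)
  · linarith

/-- The sifted two-class count with the (then automatic) range condition `v ∈ [1, N]` removed.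
[cite: Vaughan1997, §3.2 (the main term of a binary problem as a sifted count)] -/
theorem card_filter_range_coprime_eq {A L N : ℕ} (n P : ℕ)
    (hval : ∀ xy ∈ pairBox A A L, xy.1 ^ 3 + 2 * xy.2 ^ 3 ∈ Icc 1 N) :
    #{xy ∈ Ioc A (A + L) ×ˢ Ioc A (A + L) |
        (xy.1 ^ 3 + 2 * xy.2 ^ 3 ∈ Icc 1 N ∧ Nat.Coprime (xy.1 ^ 3 + 2 * xy.2 ^ 3) P) ∧
          Nat.Coprime (n - (xy.1 ^ 3 + 2 * xy.2 ^ 3)) P} =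
      #{xy ∈ pairBox A A L | (pairValue xy).Coprime P ∧ (n - pairValue xy).Coprime P} := by
  rw [pairBox]
  congr 1
  refine filter_congr fun xy hxy => ?_
  rw [pairValue_def]
  exact ⟨fun h => ⟨h.1.2, h.2⟩, fun h => ⟨⟨hval xy (by rwa [pairBox]), h.1⟩, h.2⟩⟩

/-- The final algebra of the main term: from `c₁M − E₁ ≤ QT`, `|R − M| ≤ E₂`, `E₁ ≤ c₁M/2`,
`E₂ ≤ M/2`, `M > 0`, `U ≥ 0` conclude `(c₁/4)·U ≤ (U/R)·QT`. [folklore] -/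
private theorem mainTerm_algebra {c₁ M Q T R E₁ E₂ U : ℝ} (hc₁ : 0 < c₁) (hM : 0 < M) (hU : 0 ≤ U)
    (hlow : c₁ * M - E₁ ≤ Q * T) (hE₁ : E₁ ≤ c₁ * M / 2) (hR : |R - M| ≤ E₂) (hE₂ : E₂ ≤ M / 2) :
    c₁ / 4 * U ≤ U / R * (Q * T) := by
  obtain ⟨hR₁, hR₂⟩ := abs_le.mp hR
  have hRpos : 0 < R := by linarith
  have key : c₁ / 4 * R ≤ Q * T := by nlinarith
  calc c₁ / 4 * U = U * (c₁ / 4) := by ring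
    _ ≤ U * (Q * T / R) := mul_le_mul_of_nonneg_left ((le_div_iff₀ hRpos).mpr key) hU
    _ = U / R * (Q * T) := by ring

/-! ### The main term of the box model -/

/-- **The sieve main term of the box model against the rough model** (inlined form): there is an
absolute `c₀ > 0` such that for all `c, B > 0`, `N ≥ N₀(c, B)` and every even `n ∈ (N, 2N]`,
`c₀ · U ≤ ∑_{k ∈ [1,N]} ũ(k) g(n − k)`, where `U = ∑_{k ≤ N} f₃(k)`, `g` is the rough model at `2N`,
`ũ(k) = (U/R) #{(x,y) ∈ ℬ : x³+2y³ = k, (k, P) = 1}`, `R = #{(x,y) ∈ ℬ : (x³+2y³, P) = 1}`, `ℬ`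
Heath-Brown's box. [cite: HalberstamRichert1974, Thm 2.5 (Fundamental Lemma) with Thm 2.2] -/
theorem boxModel_mainTerm_lower' :
    ∃ c₀ : ℝ, 0 < c₀ ∧ ∀ c B : ℝ, 0 < c → 0 < B → ∃ N₀ : ℕ, ∀ N : ℕ, N₀ ≤ N → ∀ n : ℕ, N < n →
      n ≤ 2 * N → Even n →
      c₀ * (∑ k ∈ Icc 1 N, hbWeight c N k) ≤
        ∑ k ∈ Icc 1 N,
          (∑ k ∈ Icc 1 N, hbWeight c N k) /
              (#{xy ∈ (Iic ⌊hbX N * (1 + hbEta c N)⌋₊ ×ˢ Iic ⌊hbX N * (1 + hbEta c N)⌋₊).filter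
                  (fun xy : ℕ × ℕ => hbX N < xy.1 ∧ (xy.1 : ℝ) ≤ hbX N * (1 + hbEta c N) ∧
                    hbX N < xy.2 ∧ (xy.2 : ℝ) ≤ hbX N * (1 + hbEta c N)) |
                Nat.Coprime (xy.1 ^ 3 + 2 * xy.2 ^ 3) (roughPrimorial B (2 * N))} : ℝ) *
            (#{xy ∈ (Iic ⌊hbX N * (1 + hbEta c N)⌋₊ ×ˢ Iic ⌊hbX N * (1 + hbEta c N)⌋₊).filter
                  (fun xy : ℕ × ℕ => hbX N < xy.1 ∧ (xy.1 : ℝ) ≤ hbX N * (1 + hbEta c N) ∧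
                    hbX N < xy.2 ∧ (xy.2 : ℝ) ≤ hbX N * (1 + hbEta c N)) |
                xy.1 ^ 3 + 2 * xy.2 ^ 3 = k ∧ Nat.Coprime k (roughPrimorial B (2 * N))} : ℝ) *
          roughModel B (2 * N) (n - k) := by
  -- constants: the two Fundamental-Lemma constants, `c₁`, the dimension constant `K`, `J`, `C_T`
  obtain ⟨C₁, hC₁, hlow⟩ := twoClassCount_box_weighted_ge
  obtain ⟨C₂, hC₂, hone⟩ := abs_oneClassCount_box_sub_le
  have hc₁ : 0 < localFactorConst := localFactorConst_pos
  have hK : 0 < CubicSieve.dimConst := by unfold CubicSieve.dimConst; exact Real.exp_pos _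
  obtain ⟨J, hJ1, hJa, hJb⟩ := exists_nat_exp_neg_le
    (a := localFactorConst / (4 * C₁)) (b := 1 / (4 * C₂)) (by positivity) (by positivity)
  have hJ0 : (0 : ℝ) < J := by exact_mod_cast hJ1
  have hC₁J : C₁ * Real.exp (-(J : ℝ)) ≤ localFactorConst / 4 := by
    calc C₁ * Real.exp (-(J : ℝ)) ≤ C₁ * (localFactorConst / (4 * C₁)) :=
          mul_le_mul_of_nonneg_left hJa hC₁.le
      _ = localFactorConst / 4 := by field_simp
  have hC₂J : C₂ * Real.exp (-(J : ℝ)) ≤ 1 / 4 := by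
    calc C₂ * Real.exp (-(J : ℝ)) ≤ C₂ * (1 / (4 * C₂)) := mul_le_mul_of_nonneg_left hJb hC₂.le
      _ = 1 / 4 := by field_simp
  set CT : ℝ := 64 * CubicSieve.dimConst * (J : ℝ) ^ 16 * (C₁ / localFactorConst + C₂) + 1 with hCT
  have hCT1 : 1 ≤ CT := by
    have : 0 ≤ 64 * CubicSieve.dimConst * (J : ℝ) ^ 16 * (C₁ / localFactorConst + C₂) := by positivity
    linarith
  have hCTa : 64 * CubicSieve.dimConst * (J : ℝ) ^ 16 * (C₁ / localFactorConst) ≤ CT := by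
    have : 0 ≤ 64 * CubicSieve.dimConst * (J : ℝ) ^ 16 * C₂ := by positivity
    rw [hCT]; nlinarith
  have hCTb : 64 * CubicSieve.dimConst * (J : ℝ) ^ 16 * C₂ ≤ CT := by
    have : 0 ≤ 64 * CubicSieve.dimConst * (J : ℝ) ^ 16 * (C₁ / localFactorConst) := by positivity
    rw [hCT]; nlinarith
  refine ⟨localFactorConst / 4, by positivity, fun c B hc hB => ?_⟩
  -- the three eventual conditions
  have e1 := eventually_three_mul_floor_cube_le hc
  have e2 := eventually_mul_roughLevel_pow_le_hbSide c CT hB (J + 20)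
  have e3 := (tendsto_roughLevel_two_mul_atTop hB).eventually_ge_atTop 3
  obtain ⟨N₀, hN₀⟩ := eventually_atTop.mp (e1.and (e2.and e3))
  refine ⟨N₀, fun N hN n hNn hn2 hn => ?_⟩
  obtain ⟨hM3, hLT, hz3⟩ := hN₀ N hN
  -- rewrite the box as the integer box `(A, A+L]²` and apply the rearrangement
  rw [hbBox_eq c N, Ioc_floor_eq_Ioc_add_hbSide c N, sum_boxModel_mul_roughModel_eq]
  -- names
  set A : ℕ := ⌊hbX N⌋₊ with hA
  set L : ℕ := hbSide c N with hL
  set z : ℝ := roughLevel B (2 * N) with hz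
  set U : ℝ := ∑ k ∈ Icc 1 N, hbWeight c N k with hU
  have hLdef : L = ⌊hbX N * (1 + hbEta c N)⌋₊ - A := rfl
  -- basic facts on `z`, `D = z^J`, `L`
  have hz2 : (2 : ℝ) ≤ z := by linarith
  have hz1 : (1 : ℝ) ≤ z := by linarith
  have hz0 : (0 : ℝ) < z := by linarith
  have hlogz0 : 0 < Real.log z := Real.log_pos (by linarith)
  have hlogz_le : Real.log z ≤ z := (Real.log_le_sub_one_of_pos hz0).trans (by linarith)
  set D : ℝ := z ^ J with hD
  have hzD : z ≤ D := le_self_pow₀ hz1 (by omega)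
  have hD2 : 2 ≤ D := hz2.trans hzD
  have hD0 : 0 < D := by linarith
  have hD1 : 1 ≤ D := by linarith
  have hlogD : Real.log D = J * Real.log z := by rw [hD, Real.log_pow]
  have hexp : Real.exp (-(Real.log D / Real.log z)) = Real.exp (-(J : ℝ)) := by
    rw [hlogD, mul_div_cancel_right₀ _ hlogz0.ne']
  have hlogD0 : 0 ≤ Real.log D := Real.log_nonneg hD1
  have hlogD_le : Real.log D ≤ J * z := by
    rw [hlogD]; exact mul_le_mul_of_nonneg_left hlogz_le hJ0.le
  have hJz1 : 1 ≤ (J : ℝ) * z := one_le_mul_of_one_le_of_one_le (by exact_mod_cast hJ1) hz1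
  have hlog16 : Real.log D ^ 16 ≤ ((J : ℝ) * z) ^ 16 := pow_le_pow_left₀ hlogD0 hlogD_le 16
  have hlog8 : Real.log D ^ 8 ≤ ((J : ℝ) * z) ^ 16 :=
    (pow_le_pow_left₀ hlogD0 hlogD_le 8).trans (pow_le_pow_right₀ hJz1 (by norm_num))
  have hzpow1 : (1 : ℝ) ≤ z ^ (J + 20) := one_le_pow₀ hz1
  have hL1r : (1 : ℝ) ≤ L := (one_le_mul_of_one_le_of_one_le hCT1 hzpow1).trans hLT
  have hL1 : 1 ≤ L := by exact_mod_cast hL1r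
  have hL0 : (0 : ℝ) < L := by linarith
  have hDL : D ≤ L := by
    calc D = z ^ J := rfl
      _ ≤ z ^ (J + 20) := pow_le_pow_right₀ hz1 (by omega)
      _ ≤ CT * z ^ (J + 20) := le_mul_of_one_le_left (by positivity) hCT1
      _ ≤ L := hLT
  have hAM : A ≤ ⌊hbX N * (1 + hbEta c N)⌋₊ := by
    have : 0 < ⌊hbX N * (1 + hbEta c N)⌋₊ - A := by rw [← hLdef]; exact hL1
    omega
  have hAL : A + L = ⌊hbX N * (1 + hbEta c N)⌋₊ := by rw [hLdef]; omega
  have hM3nat : 3 * ⌊hbX N * (1 + hbEta c N)⌋₊ ^ 3 ≤ N := by exact_mod_cast hM3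
  have hval := pairBox_value_mem_Icc hAL hM3nat
  have htop : (A + L) ^ 3 + 2 * (A + L) ^ 3 < n := by rw [hAL]; linarith
  -- remove the range condition from the sifted count
  rw [card_filter_range_coprime_eq n (roughPrimorial B (2 * N)) hval]
  -- the sieve inputs at `A A L n z D`
  have hlow' := hlow A A L n z D hn htop hz2 hzD hD2
  have hone' := hone A A L z D hz2 hzD hD2
  rw [hexp] at hlow' hone'
  -- positivity of the main term `M = L² V(z)`
  have hV0 : 0 < oneClassProduct z := oneClassProduct_pos z
  have hM : 0 < (L : ℝ) ^ 2 * oneClassProduct z := mul_pos (pow_pos hL0 2) hV0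
  have hU0 : 0 ≤ U := sum_nonneg fun k _ => hbWeight_nonneg c N k
  -- `1 ≤ V(z) · 8K z³` (the `Ω(3)` lower bound for `V(z)` and `log z/log 2 ≤ 2z`)
  have hlog2 : 0 < Real.log 2 := Real.log_pos (by norm_num)
  set t : ℝ := Real.log z / Real.log 2 with ht
  have ht0 : 0 < t := div_pos hlogz0 hlog2
  have ht2z : t ≤ 2 * z := by
    have h1 : t ≤ z / Real.log 2 := div_le_div_of_nonneg_right hlogz_le hlog2.le
    have h2 : z / Real.log 2 ≤ 2 * z := by
      rw [div_le_iff₀ hlog2]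
      have hl : (1 : ℝ) ≤ 2 * Real.log 2 := by
        have := Real.log_two_gt_d9
        linarith
      calc z = z * 1 := (mul_one z).symm
        _ ≤ z * (2 * Real.log 2) := mul_le_mul_of_nonneg_left hl hz0.le
        _ = 2 * z * Real.log 2 := by ring
    exact h1.trans h2
  have hKt : 0 < CubicSieve.dimConst * t ^ 3 := by positivity
  have hVlow : (CubicSieve.dimConst * t ^ 3)⁻¹ ≤ oneClassProduct z := oneClassProduct_ge hz2
  have hV8 : 1 ≤ oneClassProduct z * (8 * CubicSieve.dimConst * z ^ 3) := by
    have h1 : 1 ≤ oneClassProduct z * (CubicSieve.dimConst * t ^ 3) := by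
      calc (1 : ℝ) = (CubicSieve.dimConst * t ^ 3)⁻¹ * (CubicSieve.dimConst * t ^ 3) :=
            (inv_mul_cancel₀ hKt.ne').symm
        _ ≤ oneClassProduct z * (CubicSieve.dimConst * t ^ 3) :=
            mul_le_mul_of_nonneg_right hVlow hKt.le
    have h2 : CubicSieve.dimConst * t ^ 3 ≤ 8 * CubicSieve.dimConst * z ^ 3 := by
      have : t ^ 3 ≤ (2 * z) ^ 3 := pow_le_pow_left₀ ht0.le ht2z 3
      calc CubicSieve.dimConst * t ^ 3 ≤ CubicSieve.dimConst * (2 * z) ^ 3 :=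
            mul_le_mul_of_nonneg_left this hK.le
        _ = 8 * CubicSieve.dimConst * z ^ 3 := by ring
    exact h1.trans (mul_le_mul_of_nonneg_left h2 hV0.le)
  have h8 : 0 < 8 * CubicSieve.dimConst * z ^ 3 := by positivity
  -- the remainder-type error terms are `≤ 2 J^16 z^{J+16} L`
  have hW : ((L : ℝ) + D) * D ≤ 2 * L * z ^ J := by
    calc ((L : ℝ) + D) * D ≤ (2 * L) * D := mul_le_mul_of_nonneg_right (by linarith) hD0.le
      _ = 2 * L * z ^ J := by rw [hD]
  have hW0 : 0 ≤ ((L : ℝ) + D) * D := by positivity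
  have hW16 : ((L : ℝ) + D) * D * Real.log D ^ 16 ≤ 2 * L * z ^ J * ((J : ℝ) * z) ^ 16 :=
    mul_le_mul hW hlog16 (pow_nonneg hlogD0 16) (by positivity)
  have hW8 : ((L : ℝ) + D) * D * Real.log D ^ 8 ≤ 2 * L * z ^ J * ((J : ℝ) * z) ^ 16 :=
    mul_le_mul hW hlog8 (pow_nonneg hlogD0 8) (by positivity)
  -- `P/φ(P) ≤ z`
  have hQz : (primesProdBelow z : ℝ) / (Nat.totient (primesProdBelow z) : ℝ) ≤ z :=
    primesProdBelow_div_totient_le hz2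
  have hQ0 : 0 ≤ (primesProdBelow z : ℝ) / (Nat.totient (primesProdBelow z) : ℝ) := by positivity
  -- error bound (i): `C₁ Q (L+D) D (log D)^16 ≤ (c₁/4) L² V`
  have hi : C₁ * ((primesProdBelow z : ℝ) / (Nat.totient (primesProdBelow z) : ℝ) *
        (((L : ℝ) + D) * D * Real.log D ^ 16)) ≤
      localFactorConst / 4 * ((L : ℝ) ^ 2 * oneClassProduct z) := by
    have step1 : C₁ * ((primesProdBelow z : ℝ) / (Nat.totient (primesProdBelow z) : ℝ) *
          (((L : ℝ) + D) * D * Real.log D ^ 16)) ≤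
        C₁ * (z * (2 * L * z ^ J * ((J : ℝ) * z) ^ 16)) :=
      mul_le_mul_of_nonneg_left (mul_le_mul hQz hW16
        (mul_nonneg hW0 (pow_nonneg hlogD0 16)) hz0.le) hC₁.le
    have hb : 64 * CubicSieve.dimConst * (J : ℝ) ^ 16 * (C₁ / localFactorConst) * z ^ (J + 20) ≤ L :=
      (mul_le_mul_of_nonneg_right hCTa (by positivity)).trans hLT
    have step2 : C₁ * (z * (2 * L * z ^ J * ((J : ℝ) * z) ^ 16)) * (8 * CubicSieve.dimConst * z ^ 3) ≤
        localFactorConst / 4 * (L : ℝ) ^ 2 := by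
      have e : C₁ * (z * (2 * L * z ^ J * ((J : ℝ) * z) ^ 16)) * (8 * CubicSieve.dimConst * z ^ 3) =
          localFactorConst / 4 * L *
            (64 * CubicSieve.dimConst * (J : ℝ) ^ 16 * (C₁ / localFactorConst) * z ^ (J + 20)) := by
        field_simp
        ring
      rw [e]
      calc localFactorConst / 4 * (L : ℝ) *
            (64 * CubicSieve.dimConst * (J : ℝ) ^ 16 * (C₁ / localFactorConst) * z ^ (J + 20))
          ≤ localFactorConst / 4 * L * L := mul_le_mul_of_nonneg_left hb (by positivity)
        _ = localFactorConst / 4 * (L : ℝ) ^ 2 := by ring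
    refine le_of_mul_le_mul_right ?_ h8
    calc C₁ * ((primesProdBelow z : ℝ) / (Nat.totient (primesProdBelow z) : ℝ) *
            (((L : ℝ) + D) * D * Real.log D ^ 16)) * (8 * CubicSieve.dimConst * z ^ 3)
        ≤ C₁ * (z * (2 * L * z ^ J * ((J : ℝ) * z) ^ 16)) * (8 * CubicSieve.dimConst * z ^ 3) :=
          mul_le_mul_of_nonneg_right step1 h8.le
      _ ≤ localFactorConst / 4 * (L : ℝ) ^ 2 := step2
      _ = localFactorConst / 4 * (L : ℝ) ^ 2 * 1 := (mul_one _).symm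
      _ ≤ localFactorConst / 4 * (L : ℝ) ^ 2 *
            (oneClassProduct z * (8 * CubicSieve.dimConst * z ^ 3)) :=
          mul_le_mul_of_nonneg_left hV8 (by positivity)
      _ = localFactorConst / 4 * ((L : ℝ) ^ 2 * oneClassProduct z) *
            (8 * CubicSieve.dimConst * z ^ 3) := by ring
  -- error bound (ii): `C₂ (L+D) D (log D)^8 ≤ (1/4) L² V`
  have hii : C₂ * (((L : ℝ) + D) * D * Real.log D ^ 8) ≤ 1 / 4 * ((L : ℝ) ^ 2 * oneClassProduct z) := by
    have step1 : C₂ * (((L : ℝ) + D) * D * Real.log D ^ 8) ≤ C₂ * (2 * L * z ^ J * ((J : ℝ) * z) ^ 16) :=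
      mul_le_mul_of_nonneg_left hW8 hC₂.le
    have hb : 64 * CubicSieve.dimConst * (J : ℝ) ^ 16 * C₂ * z ^ (J + 20) ≤ L :=
      (mul_le_mul_of_nonneg_right hCTb (by positivity)).trans hLT
    have hb' : 64 * CubicSieve.dimConst * (J : ℝ) ^ 16 * C₂ * z ^ (J + 19) ≤ L := by
      refine le_trans ?_ hb
      exact mul_le_mul_of_nonneg_left (pow_le_pow_right₀ hz1 (by omega)) (by positivity)
    have step2 : C₂ * (2 * L * z ^ J * ((J : ℝ) * z) ^ 16) * (8 * CubicSieve.dimConst * z ^ 3) ≤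
        1 / 4 * (L : ℝ) ^ 2 := by
      have e : C₂ * (2 * L * z ^ J * ((J : ℝ) * z) ^ 16) * (8 * CubicSieve.dimConst * z ^ 3) =
          1 / 4 * L * (64 * CubicSieve.dimConst * (J : ℝ) ^ 16 * C₂ * z ^ (J + 19)) := by ring
      rw [e]
      calc 1 / 4 * (L : ℝ) * (64 * CubicSieve.dimConst * (J : ℝ) ^ 16 * C₂ * z ^ (J + 19))
          ≤ 1 / 4 * L * L := mul_le_mul_of_nonneg_left hb' (by positivity)
        _ = 1 / 4 * (L : ℝ) ^ 2 := by ring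
    refine le_of_mul_le_mul_right ?_ h8
    calc C₂ * (((L : ℝ) + D) * D * Real.log D ^ 8) * (8 * CubicSieve.dimConst * z ^ 3)
        ≤ C₂ * (2 * L * z ^ J * ((J : ℝ) * z) ^ 16) * (8 * CubicSieve.dimConst * z ^ 3) :=
          mul_le_mul_of_nonneg_right step1 h8.le
      _ ≤ 1 / 4 * (L : ℝ) ^ 2 := step2
      _ = 1 / 4 * (L : ℝ) ^ 2 * 1 := (mul_one _).symm
      _ ≤ 1 / 4 * (L : ℝ) ^ 2 * (oneClassProduct z * (8 * CubicSieve.dimConst * z ^ 3)) :=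
          mul_le_mul_of_nonneg_left hV8 (by positivity)
      _ = 1 / 4 * ((L : ℝ) ^ 2 * oneClassProduct z) * (8 * CubicSieve.dimConst * z ^ 3) := by ring
  -- the two error budgets
  have hE₁ : C₁ * ((L : ℝ) ^ 2 * oneClassProduct z * Real.exp (-(J : ℝ)) +
        (primesProdBelow z : ℝ) / (Nat.totient (primesProdBelow z) : ℝ) *
          (((L : ℝ) + D) * D * Real.log D ^ 16)) ≤
      localFactorConst * ((L : ℝ) ^ 2 * oneClassProduct z) / 2 := by
    have h1 : C₁ * ((L : ℝ) ^ 2 * oneClassProduct z * Real.exp (-(J : ℝ))) ≤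
        localFactorConst / 4 * ((L : ℝ) ^ 2 * oneClassProduct z) := by
      calc C₁ * ((L : ℝ) ^ 2 * oneClassProduct z * Real.exp (-(J : ℝ)))
          = (C₁ * Real.exp (-(J : ℝ))) * ((L : ℝ) ^ 2 * oneClassProduct z) := by ring
        _ ≤ localFactorConst / 4 * ((L : ℝ) ^ 2 * oneClassProduct z) :=
          mul_le_mul_of_nonneg_right hC₁J hM.le
    rw [mul_add]
    linarith
  have hE₂ : C₂ * ((L : ℝ) ^ 2 * oneClassProduct z * Real.exp (-(J : ℝ)) +
        ((L : ℝ) + D) * D * Real.log D ^ 8) ≤ (L : ℝ) ^ 2 * oneClassProduct z / 2 := by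
    have h1 : C₂ * ((L : ℝ) ^ 2 * oneClassProduct z * Real.exp (-(J : ℝ))) ≤
        1 / 4 * ((L : ℝ) ^ 2 * oneClassProduct z) := by
      calc C₂ * ((L : ℝ) ^ 2 * oneClassProduct z * Real.exp (-(J : ℝ)))
          = (C₂ * Real.exp (-(J : ℝ))) * ((L : ℝ) ^ 2 * oneClassProduct z) := by ring
        _ ≤ 1 / 4 * ((L : ℝ) ^ 2 * oneClassProduct z) := mul_le_mul_of_nonneg_right hC₂J hM.le
    rw [mul_add]
    linarith
  exact mainTerm_algebra hc₁ hM hU0 hlow' hE₁ hone' hE₂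

/-- **The sieve main term of the box model against the rough model** — VERBATIM the `let`-form in
which the binary problem `n = p + (x³ + 2y³)` consumes it (parity-ideate route
`GoldbachHeathBrownDispersion`, crux «ModelMainTerm»): there is an absolute `c₀ > 0` such that for all
`c, B > 0`, `N ≥ N₀(c, B)` and every even `n ∈ (N, 2N]`, with `X = hbX N`, `η = hbEta c N`,
`P = roughPrimorial B (2N)`, the box `{X < x, y ≤ X(1+η)}`, `U = ∑_{k ≤ N} hbWeight c N k`,
`R = #{box pairs with (x³+2y³, P) = 1}` and `ũ(m) = (U/R) #{box pairs with x³+2y³ = m, (m, P) = 1}`: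
`c₀ U ≤ ∑_{k ∈ [1,N]} ũ(k) · roughModel B (2N) (n − k)`.
[cite: HalberstamRichert1974, Thm 2.5 (Fundamental Lemma) with Thm 2.2] -/
theorem boxModel_mainTerm_lower :
    ∃ c₀ : ℝ, 0 < c₀ ∧ ∀ c B : ℝ, 0 < c → 0 < B → ∃ N₀ : ℕ, ∀ N : ℕ, N₀ ≤ N → ∀ n : ℕ, N < n →
      n ≤ 2 * N → Even n →
      let X : ℝ := hbX N
      let η : ℝ := hbEta c N
      let P : ℕ := roughPrimorial B (2 * N)
      let box : Finset (ℕ × ℕ) := Finset.filter (fun xy : ℕ × ℕ => X < xy.1 ∧ (xy.1 : ℝ) ≤ X * (1 + η) ∧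
        X < xy.2 ∧ (xy.2 : ℝ) ≤ X * (1 + η)) (Finset.Iic ⌊X * (1 + η)⌋₊ ×ˢ Finset.Iic ⌊X * (1 + η)⌋₊)
      let U : ℝ := ∑ k ∈ Finset.Icc 1 N, hbWeight c N k
      let R : ℝ := ((Finset.filter (fun xy : ℕ × ℕ => Nat.Coprime (xy.1 ^ 3 + 2 * xy.2 ^ 3) P) box).card : ℝ)
      let ũ : ℕ → ℝ := fun m => U / R *
        ((Finset.filter (fun xy : ℕ × ℕ => xy.1 ^ 3 + 2 * xy.2 ^ 3 = m ∧ Nat.Coprime m P) box).card : ℝ)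
      c₀ * U ≤ ∑ k ∈ Finset.Icc 1 N, ũ k * roughModel B (2 * N) (n - k) := by
  obtain ⟨c₀, hc₀, h⟩ := boxModel_mainTerm_lower'
  refine ⟨c₀, hc₀, fun c B hc hB => ?_⟩
  obtain ⟨N₀, hN₀⟩ := h c B hc hB
  exact ⟨N₀, fun N hN n hNn hn2 hn => hN₀ N hN n hNn hn2 hn⟩

end Literature.NumberTheory.Sieve.CubicMinorant

end
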